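import Summits.QuantumFields.BalabanUV.T4Continuum.Spine.NE1p.DressedSmallFieldSlotLettersWitnessMass

/-!
# T⁴ programme, spine estimate NE1′ (node O3b/H2) — WITNESS W⟨next⟩ (follower of W58 «THE SLOT-LETTERS END FIRES ON THE TORUS»; OPEN OFFER
# O-g15a, typer R-T138): THE μ-PART ENDs FIRE ON W58's DATUM — S31 §1's `muPart_locE_le_of_coreLettersOf_torus`, S36 §1's
# `muPart_locE_le_of_coreLettersOf_factorMass_torus` and S38 §1's `muPart_locE_le_of_coreLettersOf_herm_torus` APPLIED ONCE BY NAME each, for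
# EVERY driven two-run object `D` and EVERY run-B background `U`, along the SOURCE pencil `0 + sμ • wW D` at the history radius `μ₁ := 2`
# with the response radius `0 < μ₀ < 2` DISPLAYED; the dressed slot activity along the pencil IN CLOSED FORM `e^{sμ·sW} − 1`; and the
# μ-part's bounded quantity VANISHES IFF `sμ = 0` on the closed source disc `‖sμ‖ ≤ 2`

Cell `pub-balaban`, sub-cell `t4`, row NE1′ formalisation crew (`t4/formal/NE1p/LEAVES.md` row W⟨next⟩ — OPEN OFFER O-g15a of typer R-T138
«S31 §1's μ-part twin … and S50-A∕S36∕S38's μ-part∕joint variants NOT yet fired on W58's datum — one-file witness tail importing W58 P2; any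
seat»; INTENT `CLAIMS.log` l.22382), unit `b2b-balaban-t4-ne1p-formalise-leaf-04` (LEAF PROVER 04, gen 16).  ADDITIVE — imports W58 PART 3
`Spine/NE1p/DressedSmallFieldSlotLettersWitnessMass` ONLY (⇒ PART 2 `…WitnessEnd`: `termsW`, `sW`, `wW`, `actSW`, `hsmall_W`, `hM3_W`,
`actOfLetters_zero_closed`, `VppM_dressed_Z₀`, `actSW_undressed`, `DW`, `UW`; ⇒ PART 1 `…Witness`: the datum `AW D`, `PW D`, `ctrW D`, S30 §1's
conditions `hbase_W`∕`hrdm_W`∕`hrd_W`∕`hctr_W`∕`hbud_W`∕`hmq_W`; PART 3: `hfloor_W`, `hent_W`, `hherm_W`, `hco_W`, `hbud_herm_W`, `hF3_W`,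
`hF3_herm_W`; ⇒ S31 `DressedSmallFieldOnCoresSlotLettersTorus`, S38 `…SlotLettersHermTorus` ⇒ S36 `…SlotLettersMassTorus`) — LANDED; THEOREMS
ONLY (0 def, 0 `def … : Prop`, 0 cite, 0 sorry); nothing of S31 ∕ S36 ∕ S38 ∕ PART 1–3 restated — used BY NAME.

WHAT.  W58 PART 2∕3 and W66 fired the ATTACHED-PART faces of S31 §1 ∕ S36 §1 ∕ S38 §1 and S50-A's three ANALYTIC faces on PART 1's decided
`ActLetters` datum; the three μ-PART (source-pencil) faces of the same ENDs had no applier (grep at INTENT: each name occurs in its own module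
only).  On the datum every displayed binder of the μ-part faces is ALREADY a named lemma (the terms that fire the attached-part faces, read at
`v := wW D`, `μ₁ := 2` — PART 2's `ϱ`), so they fire with NO new estimate:
* §12 **`actSW_pencil_closed`** — along the source pencil the summed slot activity at `X₀` is `e^{sμ·sW} − 1` IN CLOSED FORM (PART 2 §4
  `actOfLetters_zero_closed` + linearity of the `V″` read-out `VppCLMM`); `norm_actSW_pencil_le` — its size is `≤ 2·‖sμ‖·sW ≤ 1∕16` on `‖sμ‖ ≤ 2`
  (Mathlib `Complex.norm_exp_sub_one_le`).
* §13 **`slotLettersMuEnd_fires_torus D N U k h0 h02 hμ`** = S31 §1 `muPart_locE_le_of_coreLettersOf_torus D (PW D) ℂ … (AW D)` APPLIED ONCE BY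
  NAME (`o := 0`, `h₀ := 0`, `v := wW D`, `μ₁ := 2`, `A′ := 0 + 2·(A∕2)`, `hM3 := hM3_W`, `hsmall := hsmall_W`, `hrate := hrate_torus_num`, centre
  conditions `hctr_W`, budgets `hbud_W`∕`hmq_W`; `0 < μ₀ < 2`, `‖sμ‖ ≤ μ₀` DISPLAYED); conclusion LITERALLY S31's μ-part torus currency
  (`actSW D N h` IS `fun Z => Σ_{p ∈ termsW D N Z} actOfLetters … p.1 p.2 0 h`); `_closed`: the bound is `K₀(64,8)·(μ₀∕(2 − μ₀))`;
  **`slotLettersMassMuEnd_fires_torus`** = S36 §1's μ-part ONCE (floor `m⋆ := 1∕2` by `hfloor_W`, `hF3 := hF3_W`);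
  **`slotLettersHermMuEnd_fires_torus`** = S38 §1's μ-part ONCE (`hent_W`∕`hherm_W`∕`hco_W`∕`hbud_herm_W`, `hF3 := hF3_herm_W`).
* §14 GENUINE: **`actSW_pencil_eq_undressed_iff`** — `actSW D N (0 + sμ • wW D) X₀ = actSW D N 0 X₀ ↔ sμ = 0` for `‖sμ‖ ≤ 2` (`e^{z} = 1` forces
  `z ∈ 2πiℤ` — Mathlib `Complex.exp_eq_one_iff` —, and `‖sμ·sW‖ ≤ 1∕32 < 2π` forces `z = 0`; `sW ≠ 0`); **`slotLettersMuEnd_vanishes_iff`** — the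
  μ-part ENDs' bounded `locE` difference VANISHES IFF `sμ = 0` on the closed disc (W24 `exp_locE_cube` BY NAME lifts activities to outputs);
  `slotLettersMuEnd_live` — hence NONZERO at every nonzero point of the disc (P2 §6 had the point `sμ = 1` only); `slotLettersMuEnd_at_one` —
  at `sμ = 1`, `μ₀ := 1` the μ-part END bounds P2 §5's OWN quantity (`one_smul`) by `K₀(64,8)`, half of P2's closed attached-part bound `2·K₀(64,8)`
  (two different ENDs of the crew read on one datum — an observation about OUR constants, not about print).
* §15 `_SU2`: §13∕§14 at PART 2 §7's hypothesis-free `DW := drivenRecordSU (n := Fin 2) F13 0 0 1 1`, `UW`.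

HONEST FRAMING (typer R-T133∕R-T137∕R-T138 wording + rider ADOPTED).  A DECIDED TOY ([folklore]; 0 sorry; 0 citations; no `def`): three by-name
μ-part re-letterings of the crew's slot ENDs applied ONCE each to PART 1's `ActLetters` datum — a vacuity check of the μ-part faces of S31 §1 ∕
S36 §1 ∕ S38 §1 (hence of S30 §2 ∕ S32 §2 ∕ S35 §2's μ-parts at the torus) on OUR 1×1 Gaussian table, plus one closed form and one kernel «iff»
about OUR toy activity; nothing of Bałaban's (2.14) representation ([Balaban1988RGII] (2.14)–(2.15), (2.38) — TYPE∕CONTEXT) — which tables realise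
`C^{(k)}(Z₀,σ)`, `Γ_k` is NOT touched; (B1b) by definition of the toy; (B3) `hM3`∕`hF3` met BY CHOICE of `rW` — G-ne9p2-5 UNPRINTED for Bałaban's
cores; `μ₁ = 2`, `sW = 1∕(2rW)`, `2π` are OUR toy letters — k2: no numeral of print asserted; 0 binders instantiated on Bałaban's densities; no
wall item; the NE1′ wall (wording v1.8, T4-DAG v48∕v49; kind v1.7) does NOT move; R-t4r2-Q2 NOT met thereby; NE1′ ⇐ the named binders — NOT
proved, NOT printed; spine PROVED 0∕9; count 9 unchanged.  Rung (B)+1 on ONE finite four-torus — NOT infinite volume, NOT a mass gap, NOT OS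
on ℝ⁴, NOT Clay.  HONEST DEPENDENCY: continuum YM on T⁴ ⇐ BetaPertH ∧ nine spine estimates (0/9 proved); BetaPertH ⇐ (D1) ∧ (D4) ∧ CAP+tail;
G-an2-4 gates asym, D1 and NE2/3/4.
-/

noncomputable section

namespace Summit.QuantumFields.BalabanUV.T4Continuum.NE1p.DressedSmallFieldSlotLettersWitnessMu

open Set Metric MeasureTheory Complex
open scoped BigOperators Matrix
open Literature.MathematicalPhysics.QuantumFieldTheory.Balaban1983to89
open Literature.MathematicalPhysics.QuantumFieldTheory.Balaban1983to89.B12TreeDecay (K₀ K₀_pos)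
open Literature.MathematicalPhysics.QuantumFieldTheory.Balaban1983to89.B13Resummation (locE)
open Literature.MathematicalPhysics.QuantumFieldTheory.Balaban1983to89.TreeLengthTorus (TDom tsys torusTreeLen torusTreeLen_singleton)
open Literature.MathematicalPhysics.QuantumFieldTheory.Balaban1983to89.TreeLengthTorusGeometry (tgeometry TTouch)
open Summit.QuantumFields.BalabanUV.T4Continuum.B13HistMeasurable (MeasPotFrame B13HistM)
open Summit.QuantumFields.BalabanUV.T4Continuum.B13HistReadout (VppCLMM VppCLMM_apply)
open Summit.QuantumFields.BalabanUV.T4Continuum.B13Carriers (TwoRuns singleDom)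
open Summit.QuantumFields.BalabanUV.T4Continuum.SubstrateTwoRunsDriven (DrivenRuns)
open Summit.QuantumFields.BalabanUV.T4Continuum.SubstrateActivities (CoreLetters coreOf actOfLetters)
open Summit.QuantumFields.BalabanUV.T4Continuum.SubstrateSlotsOfRecord (ActLetters coreLettersOf)
open Summit.QuantumFields.BalabanUV.T4Continuum.NE1p.DressedSmallFieldOnCoresSlotLettersTorus (muPart_locE_le_of_coreLettersOf_torus)
open Summit.QuantumFields.BalabanUV.T4Continuum.NE1p.DressedSmallFieldOnCoresSlotLettersMassTorus (muPart_locE_le_of_coreLettersOf_factorMass_torus)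
open Summit.QuantumFields.BalabanUV.T4Continuum.NE1p.DressedSmallFieldOnCoresSlotLettersHermTorus (muPart_locE_le_of_coreLettersOf_herm_torus)
open Summit.QuantumFields.BalabanUV.T4Continuum.NE1p.DressedSmallFieldCoresWitness (E1 Acst Acst_pos)
open Summit.QuantumFields.BalabanUV.T4Continuum.NE1p.DressedSmallFieldTorusWitness (X₀ X₀_val eq_X₀_iff hrate_torus_num exp_locE_cube)
open Summit.QuantumFields.BalabanUV.T4Continuum.NE1p.DressedSmallFieldSlotLettersWitness
open Summit.QuantumFields.BalabanUV.T4Continuum.NE1p.DressedSmallFieldSlotLettersWitnessEnd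
open Summit.QuantumFields.BalabanUV.T4Continuum.NE1p.DressedSmallFieldSlotLettersWitnessMass

variable {G : Type} [GaugeGroup G] (D : DrivenRuns G)

section Torus
variable (N : ℕ) [NeZero N]

/-! ## §12 The dressed slot activity ALONG THE SOURCE PENCIL `0 + sμ • wW D` in closed form -/

/-- The table along the source pencil reads `sμ·sW` at the polymer's domain (linearity of the read-out `VppCLMM`; PART 2's `VppM_dressed_Z₀`). [folklore] -/
theorem VppM_pencil_Z₀ (sμ : ℂ) : (PW D).VppM ((0 : B13HistM (PW D)) + sμ • (wW D)) (Z₀ D) (fun _ => (0 : ℝ)) = sμ * (sW : ℂ) := by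
  have h := VppM_dressed_Z₀ D
  rw [zero_add] at h
  rw [zero_add, ← VppCLMM_apply, map_smul, VppCLMM_apply, smul_eq_mul, h]

/-- **THE DRESSED SLOT ACTIVITY ALONG THE SOURCE PENCIL IN CLOSED FORM**: `actSW D N (0 + sμ • wW D) X₀ = e^{sμ·sW} − 1` (PART 2 §4
`actOfLetters_zero_closed` at the one factor on `X₀`). [folklore] -/
theorem actSW_pencil_closed (sμ : ℂ) :
    (actSW D) N ((0 : B13HistM (PW D)) + sμ • (wW D)) (X₀ N) = cexp (sμ * (sW : ℂ)) - 1 := by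
  unfold actSW; rw [termsW_X₀, Finset.sum_singleton, actOfLetters_zero_closed, VppM_pencil_Z₀]

/-- On the closed source disc `‖sμ‖ ≤ 2` the pencil's exponent is tiny: `‖sμ·sW‖ ≤ 1∕32` (`sW ≤ 1∕64`). [folklore] -/
theorem norm_pencil_exponent_le {sμ : ℂ} (hμ : ‖sμ‖ ≤ 2) : ‖sμ * (sW : ℂ)‖ ≤ 1 / 32 := by
  rw [norm_mul, Complex.norm_real, Real.norm_eq_abs, abs_of_pos sW_pos]
  nlinarith [sW_le, sW_pos, norm_nonneg sμ]

/-- … so the dressed slot activity is small: `‖actSW D N (0 + sμ • wW D) X₀‖ ≤ 1∕16 < 1` (Mathlib `Complex.norm_exp_sub_one_le`). [folklore] -/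
theorem norm_actSW_pencil_le {sμ : ℂ} (hμ : ‖sμ‖ ≤ 2) : ‖(actSW D) N ((0 : B13HistM (PW D)) + sμ • (wW D)) (X₀ N)‖ ≤ 1 / 16 := by
  rw [actSW_pencil_closed]
  have h := norm_pencil_exponent_le hμ
  exact (Complex.norm_exp_sub_one_le (h.trans (by norm_num))).trans (by linarith)

/-! ## §13 THE THREE μ-PART ENDs FIRE — S31 §1 ∕ S36 §1 ∕ S38 §1's source-pencil faces APPLIED ONCE BY NAME each -/

open Classical in
/-- **S31 §1's μ-PART END FIRES ON THE TORUS, FOR EVERY DRIVEN TWO-RUN OBJECT `D` AND EVERY RUN-B BACKGROUND `U`** [decided toy]: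
`muPart_locE_le_of_coreLettersOf_torus D (PW D) ℂ (𝒵W D) (domW D) (JcW D) (VW D) (mIW D) (AW D)` APPLIED ONCE BY NAME with `W := univ`, centres
`ctrW`, radii `ROp := 1∕2 < R′ := 1`, `RHist := 2`, letters `(β₀, ϑ, d₀, γ) := (2, ϑW, 2, 2)`, S30 §1's conditions by PART 1's
`hbase_W`∕`hrdm_W`∕`hrd_W`∕`hctr_W`∕`hbud_W`∕`hmq_W`, `g := 0`, `o := 0`, `h₀ := 0`, source direction `v := wW D` at the history radius `μ₁ := 2`,
`emb Z := D.mkDom k (singleDom 0)` (`hscale` by `rfl`), `terms := termsW D N`, `(A′, R, r₁) := (0 + 2·(A∕2), 2·(64·log 162) + 2, 0)`, W24's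
`hrate_torus_num`, `hsmall_W`, `hM3_W`; the response radius `0 < μ₀ < 2` and `‖sμ‖ ≤ μ₀` DISPLAYED.  Conclusion LITERAL. [folklore] -/
theorem slotLettersMuEnd_fires_torus (U : D.carriers.BgB) (k : ℕ) {μ₀ : ℝ} {sμ : ℂ} (h0 : 0 < μ₀) (h02 : μ₀ < 2) (hμ : ‖sμ‖ ≤ μ₀) :
    ‖locE (Dom := (tsys 4 N).Dom) (TTouch (d := 4) (N := N)) (fun Z : (tsys 4 N).Dom => Z.1)
          ((actSW D) N ((0 : B13HistM (PW D)) + sμ • (wW D))) (X₀ N).1 -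
        locE (Dom := (tsys 4 N).Dom) (TTouch (d := 4) (N := N)) (fun Z : (tsys 4 N).Dom => Z.1) ((actSW D) N 0) (X₀ N).1‖ ≤
      Real.exp 1 * 9 * 64 * K₀ 64 8 ^ 2 * (0 + 2 * (Acst / 2)) * Real.exp (-(0 * torusTreeLen (X₀ N).1)) * (μ₀ / (2 - μ₀)) :=
  muPart_locE_le_of_coreLettersOf_torus D (PW D) ℂ (𝒵W D) (domW D) (JcW D) (VW D) (mIW D) (AW D)
    (W := Set.univ) (ctr := (ctrW D)) (ROp := fun _ => 1 / 2) (RHist := fun _ => 2) (R' := fun _ => 1)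
    (β₀ := fun _ _ => 2) (ϑ := fun _ _ => ϑW) (d₀ := fun _ _ => 2) (γ := fun _ _ => 2)
    (fun _ => by norm_num) (fun _ => zero_le_one) (hbase_W D) (hrdm_W D) (fun _ _ => by norm_num) (fun _ _ => by norm_num) (hrd_W D)
    (hctr_W D) (hbud_W D) (hmq_W D)
    (k := k) (g := fun _ => 0) (Set.mem_univ _) (U := U) (o := 0) (h₀ := 0) (v := (wW D)) (μ₁ := 2)
    (by show ‖(0 : ℂ) - 0‖ ≤ 1 / 2; simp)
    (by show ‖(0 : B13HistM (PW D)) - 0‖ + 2 * ‖(wW D)‖ ≤ 2; rw [sub_zero, norm_zero, zero_add]; linarith [(norm_wW_le D), sW_le])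
    (emb := fun _ => D.mkDom k (singleDom 0)) (fun _ => rfl) ((termsW D) N)
    (A' := 0 + 2 * (Acst / 2)) (R := 2 * (64 * Real.log 162) + 2) (r₁ := 0) (μ₀ := μ₀) (X₀ N) (sμ := sμ)
    (by have := Acst_pos; linarith) le_rfl hrate_torus_num hsmall_W (hM3_W D N k) h0 h02 hμ

open Classical in
/-- … in CLOSED FORM: `≤ K₀(64,8)·(μ₀∕(2 − μ₀))` (W33's `A = (e·K₀(64,8)·9·64)⁻¹` unfolded; the decay factor is `1` on the one cube). [folklore] -/
theorem slotLettersMuEnd_fires_torus_closed (U : D.carriers.BgB) (k : ℕ) {μ₀ : ℝ} {sμ : ℂ} (h0 : 0 < μ₀) (h02 : μ₀ < 2) (hμ : ‖sμ‖ ≤ μ₀) :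
    ‖locE (Dom := (tsys 4 N).Dom) (TTouch (d := 4) (N := N)) (fun Z : (tsys 4 N).Dom => Z.1)
          ((actSW D) N ((0 : B13HistM (PW D)) + sμ • (wW D))) (X₀ N).1 -
        locE (Dom := (tsys 4 N).Dom) (TTouch (d := 4) (N := N)) (fun Z : (tsys 4 N).Dom => Z.1) ((actSW D) N 0) (X₀ N).1‖ ≤
      K₀ 64 8 * (μ₀ / (2 - μ₀)) := by
  refine ((slotLettersMuEnd_fires_torus D) N U k h0 h02 hμ).trans (le_of_eq ?_)
  rw [zero_mul, neg_zero, Real.exp_zero, mul_one]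
  unfold Acst
  have hK := K₀_pos (64 : ℝ) 8
  have he := Real.exp_pos 1
  field_simp
  ring

open Classical in
/-- **S36 §1's μ-PART END FIRES ON THE SAME DATUM — (B3) IN ROW NE5's `factorMass` CURRENCY AT THE FLOOR `m⋆ := 1∕2`** [decided toy]:
`muPart_locE_le_of_coreLettersOf_factorMass_torus D (PW D) ℂ … (AW D)` APPLIED ONCE BY NAME (PART 3's `hfloor_W` WITH EQUALITY, `hF3_W`; otherwise the
binders of `(slotLettersMuEnd_fires_torus D)`); conclusion LITERALLY the same μ-part currency. [folklore] -/
theorem slotLettersMassMuEnd_fires_torus (U : D.carriers.BgB) (k : ℕ) {μ₀ : ℝ} {sμ : ℂ} (h0 : 0 < μ₀) (h02 : μ₀ < 2) (hμ : ‖sμ‖ ≤ μ₀) :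
    ‖locE (Dom := (tsys 4 N).Dom) (TTouch (d := 4) (N := N)) (fun Z : (tsys 4 N).Dom => Z.1)
          ((actSW D) N ((0 : B13HistM (PW D)) + sμ • (wW D))) (X₀ N).1 -
        locE (Dom := (tsys 4 N).Dom) (TTouch (d := 4) (N := N)) (fun Z : (tsys 4 N).Dom => Z.1) ((actSW D) N 0) (X₀ N).1‖ ≤
      Real.exp 1 * 9 * 64 * K₀ 64 8 ^ 2 * (0 + 2 * (Acst / 2)) * Real.exp (-(0 * torusTreeLen (X₀ N).1)) * (μ₀ / (2 - μ₀)) :=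
  muPart_locE_le_of_coreLettersOf_factorMass_torus D (PW D) ℂ (𝒵W D) (domW D) (JcW D) (VW D) (mIW D) (AW D)
    (W := Set.univ) (ctr := (ctrW D)) (ROp := fun _ => 1 / 2) (RHist := fun _ => 2) (R' := fun _ => 1)
    (β₀ := fun _ _ => 2) (ϑ := fun _ _ => ϑW) (d₀ := fun _ _ => 2) (γ := fun _ _ => 2) (mstar := 1 / 2)
    (fun _ => by norm_num) (fun _ => zero_le_one) (hbase_W D) (hrdm_W D) (fun _ _ => by norm_num) (fun _ _ => by norm_num) (hrd_W D)
    (hctr_W D) (hbud_W D) (by norm_num) (hfloor_W D)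
    (k := k) (g := fun _ => 0) (Set.mem_univ _) (U := U) (o := 0) (h₀ := 0) (v := (wW D)) (μ₁ := 2)
    (by show ‖(0 : ℂ) - 0‖ ≤ 1 / 2; simp)
    (by show ‖(0 : B13HistM (PW D)) - 0‖ + 2 * ‖(wW D)‖ ≤ 2; rw [sub_zero, norm_zero, zero_add]; linarith [(norm_wW_le D), sW_le])
    (emb := fun _ => D.mkDom k (singleDom 0)) (fun _ => rfl) ((termsW D) N)
    (A' := 0 + 2 * (Acst / 2)) (R := 2 * (64 * Real.log 162) + 2) (r₁ := 0) (μ₀ := μ₀) (X₀ N) (sμ := sμ)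
    (by have := Acst_pos; linarith) le_rfl hrate_torus_num hsmall_W (hF3_W D N) h0 h02 hμ

open Classical in
/-- **S38 §1's μ-PART END FIRES ON THE SAME DATUM — THE HERMITIAN CENTRE READING** [decided toy]: `muPart_locE_le_of_coreLettersOf_herm_torus D (PW D)
ℂ … (AW D)` APPLIED ONCE BY NAME (the centre table `[2]` IS Hermitian — PART 3's `hherm_W`; `hent_W`, `hco_W`, `hbud_herm_W` at `γ^{card} = 2`, the
floor `m⋆ := 1∕2`, `hF3_herm_W`); conclusion LITERALLY the same μ-part currency. [folklore] -/
theorem slotLettersHermMuEnd_fires_torus (U : D.carriers.BgB) (k : ℕ) {μ₀ : ℝ} {sμ : ℂ} (h0 : 0 < μ₀) (h02 : μ₀ < 2) (hμ : ‖sμ‖ ≤ μ₀) :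
    ‖locE (Dom := (tsys 4 N).Dom) (TTouch (d := 4) (N := N)) (fun Z : (tsys 4 N).Dom => Z.1)
          ((actSW D) N ((0 : B13HistM (PW D)) + sμ • (wW D))) (X₀ N).1 -
        locE (Dom := (tsys 4 N).Dom) (TTouch (d := 4) (N := N)) (fun Z : (tsys 4 N).Dom => Z.1) ((actSW D) N 0) (X₀ N).1‖ ≤
      Real.exp 1 * 9 * 64 * K₀ 64 8 ^ 2 * (0 + 2 * (Acst / 2)) * Real.exp (-(0 * torusTreeLen (X₀ N).1)) * (μ₀ / (2 - μ₀)) :=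
  muPart_locE_le_of_coreLettersOf_herm_torus D (PW D) ℂ (𝒵W D) (domW D) (JcW D) (VW D) (mIW D) (AW D)
    (W := Set.univ) (ctr := (ctrW D)) (ROp := fun _ => 1 / 2) (RHist := fun _ => 2) (R' := fun _ => 1)
    (β₀ := fun _ _ => 2) (ϑ := fun _ _ => ϑW) (γ := fun _ _ => 2) (mstar := 1 / 2)
    (fun _ => by norm_num) (fun _ => zero_le_one) (hbase_W D) (hrdm_W D) (fun _ _ => by norm_num) (hrd_W D)
    (hent_W D) (hherm_W D) (hco_W D) (hbud_herm_W D) (by norm_num) (hfloor_W D)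
    (k := k) (g := fun _ => 0) (Set.mem_univ _) (U := U) (o := 0) (h₀ := 0) (v := (wW D)) (μ₁ := 2)
    (by show ‖(0 : ℂ) - 0‖ ≤ 1 / 2; simp)
    (by show ‖(0 : B13HistM (PW D)) - 0‖ + 2 * ‖(wW D)‖ ≤ 2; rw [sub_zero, norm_zero, zero_add]; linarith [(norm_wW_le D), sW_le])
    (emb := fun _ => D.mkDom k (singleDom 0)) (fun _ => rfl) ((termsW D) N)
    (A' := 0 + 2 * (Acst / 2)) (R := 2 * (64 * Real.log 162) + 2) (r₁ := 0) (μ₀ := μ₀) (X₀ N) (sμ := sμ)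
    (by have := Acst_pos; linarith) le_rfl hrate_torus_num hsmall_W (hF3_herm_W D N) h0 h02 hμ

/-! ## §14 GENUINE: the μ-part's bounded quantity VANISHES IFF `sμ = 0` on the closed source disc `‖sμ‖ ≤ 2` -/

/-- **THE DRESSED SLOT ACTIVITY ALONG THE PENCIL EQUALS THE UNDRESSED ONE IFF `sμ = 0`** (`‖sμ‖ ≤ 2`): `e^{sμ·sW} − 1 = 0` forces `sμ·sW ∈ 2πiℤ`
(Mathlib `Complex.exp_eq_one_iff`), and `‖sμ·sW‖ ≤ 1∕32 < 2π` leaves only `sμ·sW = 0`; `sW ≠ 0`. [folklore] -/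
theorem actSW_pencil_eq_undressed_iff {sμ : ℂ} (hμ : ‖sμ‖ ≤ 2) :
    (actSW D) N ((0 : B13HistM (PW D)) + sμ • (wW D)) (X₀ N) = (actSW D) N 0 (X₀ N) ↔ sμ = 0 := by
  rw [actSW_pencil_closed, actSW_undressed, sub_eq_zero]
  refine ⟨fun h => ?_, fun h => by rw [h, zero_mul, Complex.exp_zero]⟩
  obtain ⟨n, hn⟩ := Complex.exp_eq_one_iff.1 h
  have hsmall := norm_pencil_exponent_le hμ
  have hn0 : n = 0 := by
    by_contra hne
    have h1 : (1 : ℝ) ≤ |(n : ℝ)| := by exact_mod_cast Int.one_le_abs hne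
    have h2π : ‖(n : ℂ) * (2 * (Real.pi : ℂ) * I)‖ = |(n : ℝ)| * (2 * Real.pi) := by
      rw [norm_mul, norm_mul, norm_mul, Complex.norm_I, mul_one, Complex.norm_intCast, Complex.norm_real, Complex.norm_ofNat,
        Real.norm_eq_abs, abs_of_pos Real.pi_pos]
    rw [hn, h2π] at hsmall
    nlinarith [Real.pi_gt_three]
  rw [hn0, Int.cast_zero, zero_mul] at hn
  rcases mul_eq_zero.1 hn with h' | h'
  · exact h'
  · exact absurd (Complex.ofReal_eq_zero.1 h') sW_pos.ne'

/-- **THE DISC HYPOTHESIS IS LOAD-BEARING**: far off the disc, at the source value `sμ := 2πi∕sW` (norm `4π·rW ≥ 128π`), the dressed slot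
activity RETURNS to the undressed one — the closed form `e^{sμ·sW} − 1` is `2πi∕sW`-periodic in the source, so «iff `sμ = 0`» is a statement
about the disc `‖sμ‖ ≤ 2`, not about the whole source line. [folklore] -/
theorem actSW_pencil_returns :
    (actSW D) N ((0 : B13HistM (PW D)) + ((2 * (Real.pi : ℂ) * I) / (sW : ℂ)) • (wW D)) (X₀ N) = (actSW D) N 0 (X₀ N) := by
  have hsW : (sW : ℂ) ≠ 0 := Complex.ofReal_ne_zero.2 sW_pos.ne'
  rw [actSW_pencil_closed, actSW_undressed, div_mul_cancel₀ _ hsW, sub_eq_zero, Complex.exp_eq_one_iff]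
  exact ⟨1, by rw [Int.cast_one, one_mul]⟩

open Classical in
/-- **THE μ-PART ENDs' BOUNDED QUANTITY VANISHES IFF `sμ = 0`** on the closed source disc [decided toy]: equal dressed outputs at `X₀` give — by W24's
`exp_locE_cube` BY NAME (both activities lie in the unit disc, `(norm_actSW_pencil_le D)`) — equal activities, hence `sμ = 0` by
`(actSW_pencil_eq_undressed_iff D)`; conversely `sμ = 0` is the undressed table (`zero_smul`). [folklore] -/
theorem slotLettersMuEnd_vanishes_iff {sμ : ℂ} (hμ : ‖sμ‖ ≤ 2) :
    locE (Dom := (tsys 4 N).Dom) (TTouch (d := 4) (N := N)) (fun Z : (tsys 4 N).Dom => Z.1)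
        ((actSW D) N ((0 : B13HistM (PW D)) + sμ • (wW D))) (X₀ N).1 =
      locE (Dom := (tsys 4 N).Dom) (TTouch (d := 4) (N := N)) (fun Z : (tsys 4 N).Dom => Z.1) ((actSW D) N 0) (X₀ N).1 ↔ sμ = 0 := by
  refine ⟨fun h => ?_, fun h => by rw [h, zero_smul, add_zero]⟩
  have hlt1 : ‖(actSW D) N ((0 : B13HistM (PW D)) + sμ • (wW D)) (X₀ N)‖ < 1 := ((norm_actSW_pencil_le D) N hμ).trans_lt (by norm_num)
  have hlt0 : ‖(actSW D) N (0 : B13HistM (PW D)) (X₀ N)‖ < 1 := by rw [actSW_undressed, norm_zero]; exact one_pos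
  have h1 : cexp (locE (Dom := (tsys 4 N).Dom) (TTouch (d := 4) (N := N)) (fun Z : (tsys 4 N).Dom => Z.1)
      ((actSW D) N ((0 : B13HistM (PW D)) + sμ • (wW D))) (X₀ N).1) = 1 + (actSW D) N ((0 : B13HistM (PW D)) + sμ • (wW D)) (X₀ N) :=
    exp_locE_cube N (w := (actSW D) N ((0 : B13HistM (PW D)) + sμ • (wW D))) hlt1
  have h0 : cexp (locE (Dom := (tsys 4 N).Dom) (TTouch (d := 4) (N := N)) (fun Z : (tsys 4 N).Dom => Z.1)
      ((actSW D) N 0) (X₀ N).1) = 1 + (actSW D) N 0 (X₀ N) :=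
    exp_locE_cube N (w := (actSW D) N 0) hlt0
  have h' := congrArg cexp h
  rw [h1, h0, add_right_inj] at h'
  exact ((actSW_pencil_eq_undressed_iff D) N hμ).1 h'

open Classical in
/-- **… HENCE IT IS NOT ZERO AT ANY NONZERO POINT OF THE DISC** — the μ-part bounds of §13 are exercised on a quantity that is live everywhere off
the centre (PART 2 §6 had the one point `sμ = 1`). [folklore] -/
theorem slotLettersMuEnd_live {sμ : ℂ} (hμ : ‖sμ‖ ≤ 2) (hne : sμ ≠ 0) :
    locE (Dom := (tsys 4 N).Dom) (TTouch (d := 4) (N := N)) (fun Z : (tsys 4 N).Dom => Z.1)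
        ((actSW D) N ((0 : B13HistM (PW D)) + sμ • (wW D))) (X₀ N).1 ≠
      locE (Dom := (tsys 4 N).Dom) (TTouch (d := 4) (N := N)) (fun Z : (tsys 4 N).Dom => Z.1) ((actSW D) N 0) (X₀ N).1 :=
  fun h => hne (((slotLettersMuEnd_vanishes_iff D) N hμ).1 h)

open Classical in
/-- **AT `sμ = 1` THE μ-PART END BOUNDS PART 2 §5's OWN QUANTITY BY `K₀(64,8)`** (`μ₀ := 1`; `one_smul`) — half of PART 2's closed attached-part
bound `2·K₀(64,8)` (`slotLettersEnd_fires_torus_closed`): two different ENDs of the crew read on one datum; an observation about OUR constants only. [folklore] -/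
theorem slotLettersMuEnd_at_one (U : D.carriers.BgB) (k : ℕ) :
    ‖locE (Dom := (tsys 4 N).Dom) (TTouch (d := 4) (N := N)) (fun Z : (tsys 4 N).Dom => Z.1) ((actSW D) N ((0 : B13HistM (PW D)) + (wW D)))
          (X₀ N).1 -
        locE (Dom := (tsys 4 N).Dom) (TTouch (d := 4) (N := N)) (fun Z : (tsys 4 N).Dom => Z.1) ((actSW D) N 0) (X₀ N).1‖ ≤ K₀ 64 8 := by
  have h := (slotLettersMuEnd_fires_torus_closed D) N U k (μ₀ := 1) (sμ := 1) one_pos one_lt_two (by rw [norm_one])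
  rw [one_smul] at h
  refine h.trans (le_of_eq ?_)
  norm_num

end Torus

/-! ## §15 … OVER THE DRIVEN RUNS OF RECORD AT `SU(2)` (PART 2 §7's hypothesis-free `DW`, `UW`) -/

open Classical in
/-- **THE μ-PART END FIRES ON THE TORUS OVER THE DRIVEN RUNS OF RECORD AT `SU(2)`** (§13 at `D := DW`, `U := UW`, closed form). [folklore] -/
theorem slotLettersMuEnd_fires_torus_SU2 (N : ℕ) [NeZero N] (k : ℕ) {μ₀ : ℝ} {sμ : ℂ} (h0 : 0 < μ₀) (h02 : μ₀ < 2) (hμ : ‖sμ‖ ≤ μ₀) :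
    ‖locE (Dom := (tsys 4 N).Dom) (TTouch (d := 4) (N := N)) (fun Z : (tsys 4 N).Dom => Z.1)
          (actSW DW N ((0 : B13HistM (PW DW)) + sμ • wW DW)) (X₀ N).1 -
        locE (Dom := (tsys 4 N).Dom) (TTouch (d := 4) (N := N)) (fun Z : (tsys 4 N).Dom => Z.1) (actSW DW N 0) (X₀ N).1‖ ≤
      K₀ 64 8 * (μ₀ / (2 - μ₀)) :=
  slotLettersMuEnd_fires_torus_closed DW N UW k h0 h02 hμ

open Classical in
/-- … and its bounded quantity vanishes IFF `sμ = 0` there. [folklore] -/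
theorem slotLettersMuEnd_vanishes_iff_SU2 (N : ℕ) [NeZero N] {sμ : ℂ} (hμ : ‖sμ‖ ≤ 2) :
    locE (Dom := (tsys 4 N).Dom) (TTouch (d := 4) (N := N)) (fun Z : (tsys 4 N).Dom => Z.1)
        (actSW DW N ((0 : B13HistM (PW DW)) + sμ • wW DW)) (X₀ N).1 =
      locE (Dom := (tsys 4 N).Dom) (TTouch (d := 4) (N := N)) (fun Z : (tsys 4 N).Dom => Z.1) (actSW DW N 0) (X₀ N).1 ↔ sμ = 0 :=
  slotLettersMuEnd_vanishes_iff DW N hμ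

end Summit.QuantumFields.BalabanUV.T4Continuum.NE1p.DressedSmallFieldSlotLettersWitnessMu
end
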